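import Summits.QuantumFields.YangMills.Theorems.UnitScaleTiltProp7CombLadder
import HarnessLib

/-!
# Route `UnitScaleTilt`, crux K1 «MinimiserStabilityRegPr» (stmt-QuantumFields-19200), route-R E′ path (α′), S3 K-form engine, row (R4′) — FILE 9i (ℤ^d word algebra):
# THE JUNCTION FROM THE TRANSPORTED CENTRE VALUE TO THE LOCAL VALUE — `‖φ(x) − R(V(w))φ(x + disp w)‖ ≤ Σ_(letters of w) ‖∇^V φ‖` (telescoping along ANY word) and the
# per-rung inequality `N_(R(V(w)⁻¹)φ(x))(P) ≤ N_(φ(x + disp w))(P) + 2‖P − 1‖·Σ_(letters of w)‖∇^Vφ‖`: a rung commutator of ✓ `Prop7CombLadder.comm_hol_contour27_le_*` is the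
# LOCAL curvature commutator `[P, φ(q)]` ((Kg′)∕(Kg) currency) plus a plaquette defect times covariant DIFFERENCES of `φ` along the comb ((eM) currency) — never `‖φ‖`

Cell `ym3-torus`, D-0154 (3c) twin-width seat `ym-routeR-w1` (gen 6); row (R4′) (namer ★ym-ust-19200-p1 g15; standing PASS 21:15Z; LOCATE v1.1 = 19200 evidence #52 §4 (c4), §5);
the majorant «`f(q, letter)`» that px9 g3's F-H9h count (bus 22:02Z) regroups.  THEOREMS ONLY (0 `def`, 0 `sorry`); `--supports stmt-QuantumFields-19200`, count-neutral.
YM₃ on T³ is a ladder rung (R3), not the Clay problem; nothing here claims a stub, the crux, d = 4 or the mass gap.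

WHAT (ns `…Theorems.Prop7CombTransportJunction`; `ℤ^d` letters of ✓ `B7Prop1Explicit`: `hol V x w`, `stepHol`, `disp`; `𝔸` a normed ring, `V` bi-contractive).
* §1 ★★ `norm_sub_R_hol_le` — `‖φ(x) − R(V(w))φ(x + disp w)‖ ≤ Σ_(i<|w|) ‖R(stepHol V p_i w_i) φ(p_(i+1)) − φ(p_i)‖` (`p_i = x + disp(w↾i)`; forward letters give the forward covariant
  difference, backward letters the transported backward one); ★ `norm_R_hol_inv_sub_le` — the same for `‖R(V(w)⁻¹)φ(x) − φ(x + disp w)‖`.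
* §2 ★★★ `comm_rung_le_local_add_path` — `N_(R(V(w)⁻¹)φ(x))(P) ≤ N_(φ(x+disp w))(P) + 2‖P − 1‖·Σ_(i<|w|)‖(∇φ)_i‖` (✓ `Prop7CommutatorChain.comm_le_comm_add` + §1), and its squared form
  ★★ `comm_rung_sq_le` — `N² ≤ 2·N_(φ(q))(P)² + 8‖P − 1‖²·|w|·Σ_i ‖(∇φ)_i‖²` (Cauchy–Schwarz): the `f(q, letter)`-majorant for the count, (Kg′) + `a²`·(path Dirichlet sum).
HONEST SCOPE.  Word algebra + triangle∕Cauchy–Schwarz; no count, no smallness; the identification `m_y = φ₀(c_y)` and the booking are the call site's.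

References: T. Bałaban, CMP 98 (1985) 17–51 [Balaban1985Averaging] ((9) pp.18–19, (19)–(20) p.21); CMP 99 (1985) 389–434 [Balaban1985BackgroundPropagators] ((3.3)–(3.4) pp.390–391).
-/

set_option autoImplicit false

noncomputable section

open scoped BigOperators

namespace Summit.QuantumFields.YangMills.Theorems.Prop7CombTransportJunction

open Literature.MathematicalPhysics.QuantumFieldTheory.Balaban1983to89
open B7Prop1Explicit (Site Letter disp hol stepHol hol_cons hol_nil disp_cons disp_nil)
open B9Eq39Adjoint (R R_sub)
open Summit.QuantumFields.YangMills.Theorems.Prop7CommutatorChain (comm_le_comm_add)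
open Summit.QuantumFields.YangMills.Theorems.Prop7CombLadder (bicontr_hol bicontr_stepHol)
open B16Txt357ThirdOrderNonAbelian (norm_R_le)

variable {d : ℕ} {𝔸 : Type*} [NormedRing 𝔸] [NormOneClass 𝔸] (V : Site d → Fin d → 𝔸ˣ)
  (hV : ∀ (x : Site d) (κ : Fin d), ‖(V x κ : 𝔸)‖ ≤ 1 ∧ ‖(((V x κ)⁻¹ : 𝔸ˣ) : 𝔸)‖ ≤ 1)

/-! ## §1 Telescoping along a word -/

section Telescope

include hV

omit [NormOneClass 𝔸] in
/-- ★★ **TELESCOPING ALONG ANY WORD**: `‖φ(x) − R(V(w))φ(x + disp w)‖ ≤ Σ_(i<|w|) ‖R(stepHol V p_i w_i) φ(p_(i+1)) − φ(p_i)‖`, `p_i = x + disp(w↾i)` (the `i`-th letter read with a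
default `l₀` that is never used) — the deviation of `φ` from `V`-parallelism along the path, letter by letter. [cite: Balaban1985Averaging, (9) pp.18-19] -/
theorem norm_sub_R_hol_le (φ : Site d → 𝔸) (l₀ : Letter d) : ∀ (x : Site d) (w : List (Letter d)),
    ‖φ x - R (hol V x w) (φ (x + disp w))‖
      ≤ ∑ i ∈ Finset.range w.length,
          ‖R (stepHol V (x + disp (w.take i)) (w.getD i l₀)) (φ (x + disp (w.take (i + 1)))) - φ (x + disp (w.take i))‖
  | x, [] => by simp
  | x, l :: w => by
    have ih := norm_sub_R_hol_le φ l₀ (x + l.vec) w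
    rw [List.length_cons, Finset.sum_range_succ', hol_cons, disp_cons]
    simp only [List.take_succ_cons, List.take_zero, List.getD_cons_succ, List.getD_cons_zero, disp_cons, disp_nil, add_zero]
    have e : φ x - R (stepHol V x l * hol V (x + l.vec) w) (φ (x + (l.vec + disp w)))
        = (φ x - R (stepHol V x l) (φ (x + l.vec))) + R (stepHol V x l) (φ (x + l.vec) - R (hol V (x + l.vec) w) (φ (x + l.vec + disp w))) := by
      rw [B9Eq39Adjoint.R_mul, R_sub, add_assoc]; abel
    rw [e]
    refine (norm_add_le _ _).trans ?_
    rw [add_comm]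
    refine add_le_add ?_ ?_
    · refine ((norm_R_le (bicontr_stepHol V hV x l) _).trans ih).trans (le_of_eq ?_)
      refine Finset.sum_congr rfl fun i _ => ?_
      rw [add_assoc, add_assoc]
    · rw [norm_sub_rev]

/-- ★ the same for the inverse transport: `‖R(V(w)⁻¹)φ(x) − φ(x + disp w)‖ ≤ Σ_(i<|w|) ‖(∇φ)_i‖`. [cite: Balaban1985Averaging, (9) pp.18-19] -/
theorem norm_R_hol_inv_sub_le (φ : Site d → 𝔸) (l₀ : Letter d) (x : Site d) (w : List (Letter d)) :
    ‖R (hol V x w)⁻¹ (φ x) - φ (x + disp w)‖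
      ≤ ∑ i ∈ Finset.range w.length,
          ‖R (stepHol V (x + disp (w.take i)) (w.getD i l₀)) (φ (x + disp (w.take (i + 1)))) - φ (x + disp (w.take i))‖ := by
  have e : R (hol V x w)⁻¹ (φ x) - φ (x + disp w) = R (hol V x w)⁻¹ (φ x - R (hol V x w) (φ (x + disp w))) := by
    rw [R_sub, B9Eq39Adjoint.R_inv_R]
  rw [e]
  have hinv : ‖(((hol V x w)⁻¹ : 𝔸ˣ) : 𝔸)‖ ≤ 1 ∧ ‖((((hol V x w)⁻¹)⁻¹ : 𝔸ˣ) : 𝔸)‖ ≤ 1 := by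
    rw [inv_inv]; exact ⟨(bicontr_hol V hV x w).2, (bicontr_hol V hV x w).1⟩
  exact (norm_R_le hinv _).trans (norm_sub_R_hol_le V hV φ l₀ x w)

end Telescope

/-! ## §2 The per-rung junction -/

section Junction

include hV

/-- ★★★ **THE RUNG JUNCTION**: `N_(R(V(w)⁻¹)φ(x))(P) ≤ N_(φ(x + disp w))(P) + 2‖P − 1‖·Σ_(i<|w|)‖(∇φ)_i‖` — the commutator of a rung plaquette with the centre value transported along
the comb is the LOCAL curvature commutator plus a plaquette defect times covariant differences of `φ` along the path (✓ `comm_le_comm_add` + §1).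
[cite: Balaban1985Averaging, (19)-(20) p.21; Balaban1985BackgroundPropagators, (3.3)-(3.4) pp.390-391] -/
theorem comm_rung_le_local_add_path (P : 𝔸) (φ : Site d → 𝔸) (l₀ : Letter d) (x : Site d) (w : List (Letter d)) :
    ‖P * R (hol V x w)⁻¹ (φ x) - R (hol V x w)⁻¹ (φ x) * P‖
      ≤ ‖P * φ (x + disp w) - φ (x + disp w) * P‖
        + 2 * ‖P - 1‖ * ∑ i ∈ Finset.range w.length,
            ‖R (stepHol V (x + disp (w.take i)) (w.getD i l₀)) (φ (x + disp (w.take (i + 1)))) - φ (x + disp (w.take i))‖ :=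
  (comm_le_comm_add P _ _).trans (add_le_add le_rfl (mul_le_mul_of_nonneg_left (norm_R_hol_inv_sub_le V hV φ l₀ x w) (by positivity)))

/-- ★★ **SQUARED FORM** (the `f(q, letter)`-majorant for the count): `N² ≤ 2·N_(φ(q))(P)² + 8‖P − 1‖²·|w|·Σ_i‖(∇φ)_i‖²`. [cite: Balaban1985Averaging, (19)-(20) p.21] -/
theorem comm_rung_sq_le (P : 𝔸) (φ : Site d → 𝔸) (l₀ : Letter d) (x : Site d) (w : List (Letter d)) :
    ‖P * R (hol V x w)⁻¹ (φ x) - R (hol V x w)⁻¹ (φ x) * P‖ ^ 2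
      ≤ 2 * ‖P * φ (x + disp w) - φ (x + disp w) * P‖ ^ 2
        + 8 * ‖P - 1‖ ^ 2 * (w.length * ∑ i ∈ Finset.range w.length,
            ‖R (stepHol V (x + disp (w.take i)) (w.getD i l₀)) (φ (x + disp (w.take (i + 1)))) - φ (x + disp (w.take i))‖ ^ 2) := by
  have h1 := comm_rung_le_local_add_path V hV P φ l₀ x w
  have hcs := sq_sum_le_card_mul_sum_sq (s := Finset.range w.length)
    (f := fun i => ‖R (stepHol V (x + disp (w.take i)) (w.getD i l₀)) (φ (x + disp (w.take (i + 1)))) - φ (x + disp (w.take i))‖)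
  rw [Finset.card_range] at hcs
  have hS0 : 0 ≤ ∑ i ∈ Finset.range w.length,
      ‖R (stepHol V (x + disp (w.take i)) (w.getD i l₀)) (φ (x + disp (w.take (i + 1)))) - φ (x + disp (w.take i))‖ := Finset.sum_nonneg fun i _ => norm_nonneg _
  have hsq := pow_le_pow_left₀ (norm_nonneg _) h1 2
  nlinarith [hsq, hcs, hS0, norm_nonneg (P - 1), norm_nonneg (P * φ (x + disp w) - φ (x + disp w) * P),
    mul_nonneg (norm_nonneg (P - 1)) hS0, sq_nonneg (‖P * φ (x + disp w) - φ (x + disp w) * P‖ - 2 * ‖P - 1‖ * ∑ i ∈ Finset.range w.length,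
      ‖R (stepHol V (x + disp (w.take i)) (w.getD i l₀)) (φ (x + disp (w.take (i + 1)))) - φ (x + disp (w.take i))‖)]

end Junction

end Summit.QuantumFields.YangMills.Theorems.Prop7CombTransportJunction

end
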